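import Summits.AtomisticToContinuum.FouriersLaw.Theorems.BondHeatUncertaintyBoundedResponseBathHeatOctave
import HarnessLib

/-!
# BondHeatUncertainty / BoundedResponse — «Octave», supplement R: the lineage's RESIDUALS land on (OR♭₁) beneath the window
(decomp-a2c lens-1, g118, NODE 118 — CONTINGENCY FILE: to be landed ONLY IF the main file `…BathHeatOctave` landed in the lane edition
4f77fc5d (= first edition 5447e10b + docstrings), which lacks these four lemmas; if main 9054d93e landed, this file is REDUNDANT (same decls) and must NOT
be proposed.)

`lowOctaveReturnFloor_of_bathTailFloor_bathHeatWindow`: (BT₁) N107 ∧ (BHᵂ₁) ⟹ (OR♭₁); `lowOctaveReturnFloor_of_lateTailFloor_bathHeatWindow`: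
`LateTailFloor a 1 1` N109 ∧ (BHᵂ₁) ⟹ (OR♭₁) (`a ≥ 0`); beneath (S) both directly (`…_of_subdiffusiveBondHeat_bathTailFloor/_lateTailFloor`).  Mechanism: a floor
at the upper time `2cN²` plus the FREE window ceiling `B_N ≤ 𝒲_N/2 ≤ C·N/2` at the lower time `cN²` — no ceiling hypothesis (BTᶜ₁).
-/

open MeasureTheory ProbabilityTheory Filter Topology Set Function
open scoped NNReal ENNReal
open Literature.MathematicalPhysics.KineticTheory.HeatConduction
open Literature.MathematicalPhysics.KineticTheory OscillatorChain
open Literature.Probability.Process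
open Summit.AtomisticToContinuum.FouriersLaw.Theorems.SubdiffusiveBondHeat
open Summit.AtomisticToContinuum.FouriersLaw.Theorems.SubdiffusiveBondHeat.EscapeGrading
open Summit.AtomisticToContinuum.FouriersLaw.Theorems.BoundedResponse.TransientBand
open Summit.AtomisticToContinuum.FouriersLaw.Theorems.BoundedResponse.ParityFloor

namespace Summit.AtomisticToContinuum.FouriersLaw.Theorems.BoundedResponse.HeatSpreading

open Summit.AtomisticToContinuum.FouriersLaw.Theorems.BoundedResponse.TransientContact
open Summit.AtomisticToContinuum.FouriersLaw.Theses.BondHeatUncertainty (BoundedResponse SubdiffusiveBondHeat)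

section Chain

variable {ω₂ lam β γ : ℝ} {T : ℝ}

/-! ### (OR♭₁) is also the weakest of the lineage's RESIDUALS beneath the window: (BT₁) ∧ (BHᵂ₁) ⟹ (OR♭₁), `LateTailFloor a 1 1` ∧ (BHᵂ₁) ⟹ (OR♭₁)
(an increment floor follows from a floor at the upper time and the FREE window ceiling `B_N ≤ 𝒲_N/2 ≤ C·N/2` at the lower time; no (BTᶜ₁) needed) -/

/-- **NODE 107's residual feeds (OR♭₁) beneath the window**: (BT₁) `BathTailFloor 1` ∧ (BHᵂ₁) ⟹ (OR♭₁) (constant `C₁ + C/2` on the octaves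
`c ≤ c_W`). [formal bookkeeping] -/
theorem lowOctaveReturnFloor_of_bathTailFloor_bathHeatWindow (hF : BathTailFloor 1) (hW : BathHeatWindow 1) : LowOctaveReturnFloor 1 := by
  intro ω₂ lam β γ hω hl hβ hγ T hT
  obtain ⟨C, c, hc, N₀, hCN⟩ := hW ω₂ lam β γ hω hl hβ hγ T hT
  refine ⟨c, hc, fun c' hc' hc'c => ?_⟩
  obtain ⟨C₁, N₁, hC₁⟩ := hF ω₂ lam β γ hω hl hβ hγ T hT (2 * c') (by positivity)
  refine ⟨C₁ + C / 2, max N₀ (max N₁ 2), fun N hN => ?_⟩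
  have hNN₀ : N₀ ≤ N := le_trans (le_max_left _ _) hN
  have hNN₁ : N₁ ≤ N := le_trans (le_trans (le_max_left _ _) (le_max_right _ _)) hN
  have hN2 : 2 ≤ N := le_trans (le_trans (le_max_right _ _) (le_max_right _ _)) hN
  have hN2r : (0 : ℝ) ≤ (N : ℝ) ^ 2 := sq_nonneg _
  have ht0 : (0 : ℝ) ≤ c' * (N : ℝ) ^ 2 := by positivity
  have htc : c' * (N : ℝ) ^ 2 ≤ c * (N : ℝ) ^ 2 := by nlinarith
  have hWt := hCN N hNN₀ _ ⟨ht0, htc⟩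
  have hB := bathTail_le hω hl hβ hγ hT (show 1 < N by omega) ht0
  have hFN := hC₁ N hNN₁
  rw [show 2 * c' * (N : ℝ) ^ 2 = 2 * (c' * (N : ℝ) ^ 2) by ring] at hFN
  rw [Real.rpow_one] at hWt hFN
  rw [Real.rpow_one]
  linarith

/-- **NODE 109's residual feeds (OR♭₁) beneath the window**: `LateTailFloor a 1 1` ∧ (BHᵂ₁) ⟹ (OR♭₁) (`a ≥ 0`; the early piece at the light cone is
paid thermodynamically, `|B^early_N(aN)| ≤ 2γT²·aN`, the lower time by the window ceiling; constant `C₁ + 2γT²a + C/2`). [formal bookkeeping] -/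
theorem lowOctaveReturnFloor_of_lateTailFloor_bathHeatWindow {a : ℝ} (ha : 0 ≤ a) (hF : LateTailFloor a 1 1) (hW : BathHeatWindow 1) :
    LowOctaveReturnFloor 1 := by
  intro ω₂ lam β γ hω hl hβ hγ T hT
  obtain ⟨C, c, hc, N₀, hCN⟩ := hW ω₂ lam β γ hω hl hβ hγ T hT
  refine ⟨c, hc, fun c' hc' hc'c => ?_⟩
  obtain ⟨C₁, N₁, hC₁⟩ := hF ω₂ lam β γ hω hl hβ hγ T hT (2 * c') (by positivity)
  refine ⟨C₁ + 2 * γ * T ^ 2 * a + C / 2, max N₀ (max N₁ 2), fun N hN => ?_⟩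
  have hNN₀ : N₀ ≤ N := le_trans (le_max_left _ _) hN
  have hNN₁ : N₁ ≤ N := le_trans (le_trans (le_max_left _ _) (le_max_right _ _)) hN
  have hN2 : 2 ≤ N := le_trans (le_trans (le_max_right _ _) (le_max_right _ _)) hN
  have hNpos : (0 : ℝ) ≤ (N : ℝ) := Nat.cast_nonneg _
  have hN2r : (0 : ℝ) ≤ (N : ℝ) ^ 2 := sq_nonneg _
  have ht0 : (0 : ℝ) ≤ c' * (N : ℝ) ^ 2 := by positivity
  have htc : c' * (N : ℝ) ^ 2 ≤ c * (N : ℝ) ^ 2 := by nlinarith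
  have hWt := hCN N hNN₀ _ ⟨ht0, htc⟩
  have hB := bathTail_le hω hl hβ hγ hT (show 1 < N by omega) ht0
  have hFN := hC₁ N hNN₁
  rw [show 2 * c' * (N : ℝ) ^ 2 = 2 * (c' * (N : ℝ) ^ 2) by ring] at hFN
  rw [Real.rpow_one] at hFN hWt
  have hE := abs_bathTailEarly_le hω hl hβ hγ hT (show 1 < N by omega) (show (0 : ℝ) ≤ a * (N : ℝ) by positivity)
  have hE' := (abs_le.1 hE).1
  unfold bathTailLate at hFN
  rw [Real.rpow_one]
  linarith

/-- So beneath (S) every residual of record lands on (OR♭₁) directly (not only through Ohm): (S) ∧ (BT₁) ⟹ (OR♭₁), (S) ∧ `LateTailFloor a 1 1` ⟹ (OR♭₁).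
[formal bookkeeping] -/
theorem lowOctaveReturnFloor_of_subdiffusiveBondHeat_bathTailFloor (hS : SubdiffusiveBondHeat) (hF : BathTailFloor 1) : LowOctaveReturnFloor 1 :=
  lowOctaveReturnFloor_of_bathTailFloor_bathHeatWindow hF (bathHeatWindow_one_of_subdiffusiveBondHeat hS)

/-- Beneath (S), NODE 109's residual `LateTailFloor a 1 1` (`a ≥ 0`) lands on (OR♭₁) directly. [formal bookkeeping] -/
theorem lowOctaveReturnFloor_of_subdiffusiveBondHeat_lateTailFloor {a : ℝ} (ha : 0 ≤ a) (hS : SubdiffusiveBondHeat) (hF : LateTailFloor a 1 1) :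
    LowOctaveReturnFloor 1 :=
  lowOctaveReturnFloor_of_lateTailFloor_bathHeatWindow ha hF (bathHeatWindow_one_of_subdiffusiveBondHeat hS)

end Chain

end Summit.AtomisticToContinuum.FouriersLaw.Theorems.BoundedResponse.HeatSpreading
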